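import Summits.QuantumAdvantage.QuantumAdvantage.Theorems.CubicForrelationNearExactIsExactTwelveZ768Div4Dead
import Summits.QuantumAdvantage.QuantumAdvantage.Theorems.CubicForrelationNearExactIsExactTwelveZ768OffDiv4B
import Summits.QuantumAdvantage.QuantumAdvantage.Theorems.CubicForrelationNearExactIsExactKtThreeStructure

/-!
# Crux `CubicForrelation.NearExactIsExact` (stmt-QuantumAdvantage-14043) — n = 12, the OPEN window `(57/64, 29/32)`, both sides at level `≥ 6`:
  the configuration `#Z = 768` is DEAD on the whole window; every level-`≥ 6` side has a 9-flat even set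

Certificate seat `b2b-cforr-cert` (gen 26).  HONEST FRAMING: kernel-checked finite-slice lemmas (standard axioms) about cubic Boolean pairs on 12
bits — ONE configuration of the level-`≥ 6` × level-`≥ 6` branch is closed on the entire open window `57/64 < Φ < 29/32` (all sixteen undecided
values `913/1024 … 928/1024`, as far as THIS configuration is concerned).  NO new value of `θ₁₂` is claimed (`θ₁₂ ∈ [57/64, 14847/16384]`, gen 25):
the type-O branch, the level-5 branch and the `#Z = #Z′ = 512` configurations below `29/32` are untouched.  NOT summit progress.

Setting: cubic `f, g` on 12 bits, `W_g = 64u''`, `W_f = 64wf`, `e = u'' − (−1)^f`, `Z = {u'' even}`; `Σ e² = 8192(1 − Φ) < 896` on the window.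
* `tzw_budget_split`: `Σ e² = 8192(1 − Φ)`, `e` odd on `Z`, off-`Z` energy `≤ Σ e² − #Z`.
* `tzw_Z768_window_false`: `#Z = 768` and `57/64 < Φ < 1` ⇒ `False`.  (Off-`Z` energy `≤ 895 − 768 = 127`, so `4 ∣ e` off `Z` by the 10-flat
  round `tzo_off_div4_le127`; then the signed-indicator argument `tzd_Z768_div4_false`: `Ŝ ∈ 128ℤ` by affine fibre patterns versus
  `ê = Ŝ + π̂ = −64e′`, `|π̂| ≤ 63`, at an even point of the non-bent partner.)
* `tzw_Z768_window_false_symm`: the same for the `f`-side (`#{wf even} = 768`).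
* `tzw_levelSix_window_Z512`: both sides at level `≥ 6` and `57/64 < Φ < 1` ⇒ `#{u'' even} = 512` (a non-empty cubic support — `g` is not bent,
  `tw_bent_end` — of weight `≤ Σ e² ≤ 895 < 1024`; Kasami–Tokura `kt3_weights_twelve` leaves `512, 768`; `768` is dead); by symmetry also
  `#{wf even} = 512`, and both even sets are 9-flats (`mw_flat_of_minweight`).
CONSEQUENCE for the ladder below `29/32`: in the level-`≥ 6` × level-`≥ 6` branch only the 9-flat configurations remain, with
`Σ e² ∈ {772, 776, …, 892}` and slack `Σ e² − 512 ∈ [260, 380]` — the (γ)/(δ) world of gens 20–23 (off-flat trichotomy, ℓ¹ engine, (H3)/(H4))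
at larger budgets; the record pair at `57/64` (`Negative/F8ChainTwelve`) sits exactly at the excluded endpoint `Σ e² = 896`.

References: MacWilliams–Sloane (1977) Ch. 13 §3, Ch. 15; T. Kasami, N. Tokura (1970) Thm 1 (through `kt3_weights_twelve`); R. O'Donnell (2014)
§3.3.  Axioms: the standard three.
-/

set_option linter.dupNamespace false -- D-0017: single-problem summit ⇒ `QuantumAdvantage.QuantumAdvantage` by design

noncomputable section

namespace Summit.QuantumAdvantage.QuantumAdvantage.Theorems.CubicForrelation.NearExactIsExact

open Finset
open Literature.Computability.QuantumComplexity
open Literature.Computability.QuantumComplexity.BuzetChailloux (bxor zeroVec bxor_bxor_cancel_left bxor_zeroVec zeroVec_bxor bxor_comm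
  bxor_self)
open Literature.Computability.QuantumComplexity.DerivativeWalsh (W)

/-- **Budget split for a level-`≥ 6` side.**  Cubic `f, g` on 12 bits, `W_g = 64u''`, `e = u'' − (−1)^f`, `Z = {u'' even}`:
`Σ e² = 8192(1 − Φ)` (as a real identity), `e` is odd on `Z`, and `Σ_{x ∉ Z} e² ≤ Σ e² − #Z`. [this work] -/
theorem tzw_budget_split (f g : (Fin (6 + 6) → Bool) → Bool)
    (u'' : (Fin (6 + 6) → Bool) → ℤ) (hu'' : ∀ x, W (fun y => signOf (g y)) x = (2 : ℝ) ^ 6 * (u'' x : ℝ)) :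
    ((∑ x, (u'' x - sZ (f x)) ^ 2 : ℤ) : ℝ) = 8192 * (1 - forrelation f g) ∧
    (∀ x ∈ (univ.filter fun x : Fin (6 + 6) → Bool => ¬ Odd (u'' x)), Odd (u'' x - sZ (f x))) ∧
    ∑ x ∈ univ.filter (fun x => x ∉ univ.filter (fun x : Fin (6 + 6) → Bool => ¬ Odd (u'' x))), (u'' x - sZ (f x)) ^ 2 ≤
      (∑ x, (u'' x - sZ (f x)) ^ 2 : ℤ) - #(univ.filter fun x : Fin (6 + 6) → Bool => ¬ Odd (u'' x)) := by
  classical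
  set Z := univ.filter (fun x : Fin (6 + 6) → Bool => ¬ Odd (u'' x)) with hZdef
  have hmemZ : ∀ x, x ∈ Z ↔ ¬ Odd (u'' x) := fun x => by simp [hZdef]
  set e : (Fin (6 + 6) → Bool) → ℤ := fun x => u'' x - sZ (f x) with hedef
  set u : (Fin (6 + 6) → Bool) → ℤ := fun x => 4 * u'' x with hudef
  have hu : ∀ x, W (fun y => signOf (g y)) x = (2 : ℝ) ^ 4 * (u x : ℝ) := by
    intro x; rw [hu'' x]; simp only [u]; push_cast; ring
  have hbud := tw12_budget f g u hu
  have h16 : ∀ x, (u x - 4 * sZ (f x)) ^ 2 = 16 * e x ^ 2 := fun x => by simp only [u, e]; ring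
  have hBR : ((∑ x, e x ^ 2 : ℤ) : ℝ) = 8192 * (1 - forrelation f g) := by
    have h' : ((∑ x, (u x - 4 * sZ (f x)) ^ 2 : ℤ) : ℝ) = 16 * ((∑ x, e x ^ 2 : ℤ) : ℝ) := by
      rw [sum_congr rfl fun x _ => h16 x, ← mul_sum]; push_cast; ring
    rw [h'] at hbud
    linarith
  have heodd : ∀ x, x ∈ Z → Odd (e x) := by
    intro x hx
    have hev := Int.not_odd_iff_even.1 ((hmemZ x).1 hx)
    rcases tp_sZ_cases (f x) with hs | hs <;> simp only [e] <;> rw [hs]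
    · exact Int.odd_sub.2 (iff_of_false (Int.not_odd_iff_even.2 hev) (by decide))
    · exact Int.odd_sub.2 (iff_of_false (Int.not_odd_iff_even.2 hev) (by decide))
  have hsq1 : ∀ x, x ∈ Z → 1 ≤ e x ^ 2 := by
    intro x hx
    have h0 := Int.odd_iff.1 (heodd x hx)
    have : e x ≤ -1 ∨ 1 ≤ e x := by omega
    have := tp_sq_ge (k := 1) (by norm_num) this
    linarith
  have hsplit : (∑ x, e x ^ 2 : ℤ) = ∑ x ∈ Z, e x ^ 2 + ∑ x ∈ univ.filter (fun x => x ∉ Z), e x ^ 2 := by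
    rw [← sum_filter_add_sum_filter_not univ (fun x => x ∈ Z)]
    congr 1
    exact sum_congr (by ext x; simp) fun _ _ => rfl
  have hZsum : (#Z : ℤ) ≤ ∑ x ∈ Z, e x ^ 2 := by
    have h2 : ∑ x ∈ Z, (1 : ℤ) ≤ ∑ x ∈ Z, e x ^ 2 := sum_le_sum fun x hx => hsq1 x hx
    rw [sum_const, nsmul_eq_mul, mul_one] at h2
    exact h2
  exact ⟨hBR, heodd, by linarith⟩

/-- **The configuration `#Z = 768` is dead on the whole open window `(57/64, 1)`** (both sides at level `≥ 6`; module docstring).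
Finite-slice statement, NOT summit progress. [this work] -/
theorem tzw_Z768_window_false (f g : (Fin (6 + 6) → Bool) → Bool) (hf : IsDegLeFun 3 f) (hg : IsDegLeFun 3 g)
    (u'' : (Fin (6 + 6) → Bool) → ℤ) (hu'' : ∀ x, W (fun y => signOf (g y)) x = (2 : ℝ) ^ 6 * (u'' x : ℝ))
    (wf : (Fin (6 + 6) → Bool) → ℤ) (hwf : ∀ y, W (fun x => signOf (f x)) y = (2 : ℝ) ^ 6 * (wf y : ℝ))
    (h768 : #(univ.filter fun x : Fin (6 + 6) → Bool => ¬ Odd (u'' x)) = 768)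
    (hlo : (57 / 64 : ℝ) < forrelation f g) (hhi : forrelation f g < 1) : False := by
  classical
  obtain ⟨hBR, -, hoffle⟩ := tzw_budget_split f g u'' hu''
  have hB : (∑ x, (u'' x - sZ (f x)) ^ 2 : ℤ) ≤ 895 := by
    have h' : ((∑ x, (u'' x - sZ (f x)) ^ 2 : ℤ) : ℝ) < 896 := by rw [hBR]; linarith
    have h'' : (∑ x, (u'' x - sZ (f x)) ^ 2 : ℤ) < 896 := by exact_mod_cast h'
    omega
  rw [h768] at hoffle
  have hoff : ∑ x ∈ univ.filter (fun x => x ∉ univ.filter (fun x : Fin (6 + 6) → Bool => ¬ Odd (u'' x))),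
      (u'' x - sZ (f x)) ^ 2 ≤ 127 := by push_cast at hoffle; linarith
  have h4 := tzo_off_div4_le127 f g hf hg u'' hu'' h768 hoff
  exact tzd_Z768_div4_false f g hf hg u'' hu'' wf hwf h768 h4 hlo hhi

/-- **Symmetric form**: the `f`-side even set cannot have `768` points either (`Φ` is symmetric). [this work] -/
theorem tzw_Z768_window_false_symm (f g : (Fin (6 + 6) → Bool) → Bool) (hf : IsDegLeFun 3 f) (hg : IsDegLeFun 3 g)
    (u'' : (Fin (6 + 6) → Bool) → ℤ) (hu'' : ∀ x, W (fun y => signOf (g y)) x = (2 : ℝ) ^ 6 * (u'' x : ℝ))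
    (wf : (Fin (6 + 6) → Bool) → ℤ) (hwf : ∀ y, W (fun x => signOf (f x)) y = (2 : ℝ) ^ 6 * (wf y : ℝ))
    (h768' : #(univ.filter fun y : Fin (6 + 6) → Bool => ¬ Odd (wf y)) = 768)
    (hlo : (57 / 64 : ℝ) < forrelation f g) (hhi : forrelation f g < 1) : False := by
  have hΦ' : forrelation g f = forrelation f g := by
    rw [Summit.QuantumAdvantage.QuantumAdvantage.Theorems.SignedCubicForrelationNotPrBPP.Negative.HalfQuad.forrelation_comm]
  exact tzw_Z768_window_false g f hg hf wf hwf u'' hu'' h768' (by rw [hΦ']; exact hlo) (by rw [hΦ']; exact hhi)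

/-- **On the open window every level-`≥ 6` side (with a level-`≥ 6` partner) has a 9-flat even set**: cubic `f, g` on 12 bits,
`W_g = 64u''`, `W_f = 64wf`, `57/64 < Φ(f,g) < 1` ⇒ `#{u'' even} = 512`.  (`g` is not bent — `tw_bent_end` —, so the even set is a non-empty
cubic support of weight `≤ Σ e² ≤ 895 < 1024`; Kasami–Tokura (`kt3_weights_twelve`) leaves `512` or `768`, and `768` is
`tzw_Z768_window_false`.)  Finite-slice statement, NOT summit progress. [this work] -/
theorem tzw_levelSix_window_Z512 (f g : (Fin (6 + 6) → Bool) → Bool) (hf : IsDegLeFun 3 f) (hg : IsDegLeFun 3 g)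
    (u'' : (Fin (6 + 6) → Bool) → ℤ) (hu'' : ∀ x, W (fun y => signOf (g y)) x = (2 : ℝ) ^ 6 * (u'' x : ℝ))
    (wf : (Fin (6 + 6) → Bool) → ℤ) (hwf : ∀ y, W (fun x => signOf (f x)) y = (2 : ℝ) ^ 6 * (wf y : ℝ))
    (hlo : (57 / 64 : ℝ) < forrelation f g) (hhi : forrelation f g < 1) :
    #(univ.filter fun x : Fin (6 + 6) → Bool => ¬ Odd (u'' x)) = 512 := by
  classical
  set Z := univ.filter (fun x : Fin (6 + 6) → Bool => ¬ Odd (u'' x)) with hZdef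
  obtain ⟨hBR, -, hoffle⟩ := tzw_budget_split f g u'' hu''
  have hB : (∑ x, (u'' x - sZ (f x)) ^ 2 : ℤ) ≤ 895 := by
    have h' : ((∑ x, (u'' x - sZ (f x)) ^ 2 : ℤ) : ℝ) < 896 := by rw [hBR]; linarith
    have h'' : (∑ x, (u'' x - sZ (f x)) ^ 2 : ℤ) < 896 := by exact_mod_cast h'
    omega
  have hoffnn : (0 : ℤ) ≤ ∑ x ∈ univ.filter (fun x => x ∉ Z), (u'' x - sZ (f x)) ^ 2 := sum_nonneg fun x _ => sq_nonneg _
  have hZle : #Z ≤ 895 := by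
    have : (#Z : ℤ) ≤ 895 := by linarith
    exact_mod_cast this
  -- Parseval: `Σ u''² = 4096`; `g` is not bent
  have hpar : ∑ x, u'' x ^ 2 = 4096 := by
    have h := zms_sum_u_sq 2 g (fun x => 4 * u'' x) (fun x => by rw [hu'' x]; push_cast; ring)
    have e4 : ∑ x, (((4 * u'' x : ℤ)) : ℝ) ^ 2 = 16 * ∑ x, ((u'' x : ℝ)) ^ 2 := by
      rw [mul_sum]; exact sum_congr rfl fun x _ => by push_cast; ring
    rw [e4] at h
    norm_num at h
    have h' : ∑ x, ((u'' x : ℝ)) ^ 2 = 4096 := by linarith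
    exact_mod_cast h'
  have hnotall : ∃ x₁, ¬ Odd (u'' x₁) := by
    by_contra hall
    push Not at hall
    have hsq1' : ∀ x, u'' x ^ 2 = 1 := by
      have hge : ∀ x, (1 : ℤ) ≤ u'' x ^ 2 := fun x => by
        have h0 := Int.odd_iff.1 (hall x)
        have : u'' x ≤ -1 ∨ 1 ≤ u'' x := by omega
        have := tp_sq_ge (k := 1) (by norm_num) this
        linarith
      have hsum0 : ∑ x, (u'' x ^ 2 - 1 : ℤ) = 0 := by
        rw [sum_sub_distrib, hpar, sum_const, card_univ, Fintype.card_fun, Fintype.card_bool, Fintype.card_fin]; norm_num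
      intro x
      have := (sum_eq_zero_iff_of_nonneg fun y _ => by have := hge y; linarith).1 hsum0 x (mem_univ x)
      linarith
    have hbent : ∀ x, W (fun y => signOf (g y)) x ^ 2 = (2 : ℝ) ^ (6 + 6) := by
      intro x
      rw [hu'' x, mul_pow]
      have : ((u'' x : ℝ)) ^ 2 = 1 := by exact_mod_cast hsq1' x
      rw [this]; norm_num
    rcases tw_bent_end (by norm_num) f g hf hg hbent with h | h
    · rw [h] at hhi; exact lt_irrefl _ hhi
    · norm_num at h; linarith
  obtain ⟨x₁, hx₁⟩ := hnotall
  -- the even set is a cubic support of weight `512` or `768`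
  have hp : IsDegLeFun 3 (fun x => decide (Odd (u'' x))) :=
    stub_walshTower stub_axParity (6 + 6) 6 3 g u'' hg hu'' (by intro k hk hkn; omega)
  have hp' : IsDegLeFun 3 (fun x => decide (Odd (u'' x)) ^^ true) := tb_isDegLeFun_xor_const hp true
  have hfilt : (univ.filter fun x : Fin (6 + 6) → Bool => (decide (Odd (u'' x)) ^^ true) = true) = Z :=
    filter_congr fun x _ => by simp
  have hne : ∃ x, (decide (Odd (u'' x)) ^^ true) = true := ⟨x₁, by simpa using hx₁⟩
  have hRM := bb_rmWeight_holds (6 + 6) 3 (fun x => decide (Odd (u'' x)) ^^ true) hp' hne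
  rw [hfilt] at hRM
  have hZge : 512 ≤ #Z := by norm_num at hRM; omega
  have hkt := kt3_weights_twelve (fun x => decide (Odd (u'' x)) ^^ true) hp' (by rw [hfilt]; omega)
  rw [hfilt] at hkt
  rcases hkt with h | h | h | h | h | h
  · omega
  · exact h
  · exact (tzw_Z768_window_false f g hf hg u'' hu'' wf hwf h hlo hhi).elim
  · omega
  · omega
  · omega

end Summit.QuantumAdvantage.QuantumAdvantage.Theorems.CubicForrelation.NearExactIsExact

end
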